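import Summits.PneNP.PneNP.Theorems.ConvexRankGatesLinAlgGateBlindPlanting
import Summits.PneNP.PneNP.Theorems.ConvexRankGatesLinAlgGateBlindDenseRegime
import Summits.PneNP.PneNP.Theorems.ConvexRankGatesLinAlgGateBlindPermSmallDimAux

/-!
# Route ConvexRankGates, crux `LinAlgGateBlind` (stmt-PneNP-10681): SG for span programs over ANY division ring up to dimension `m^{11/16-o(1)}`

Support lemma for the research stub `stub_sgPerm` (line `dnf-invariant-wide-gates-see-small-cliques`; vocabulary of
`Theorems/ConvexRankGatesLinAlgGateBlindDefs.lean`). The landed span-program range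
(`Theorems/ConvexRankGatesLinAlgGateBlindSpanProgramSmallDim.lean`) covers the rejection region of a bundled monotone
span program `O(x) = [t ∈ span {r a : ⌈atom a⌉(x)}]`, `r a ∈ F^D`, by the all-off events of the `|F|^D` linear
functionals, so it needs a FINITE field and `D · log₂ |F| ≤ m^{3/4}/2`.

THE CHAIN COVER (same device as for `PERM` gates, `…Theorems.ConvexRankGatesLinAlgGateBlindChainCover`): the live span
`W = span {r a : a live}` of a rejected graph is spanned by the rows of at most `D` live ATOMS (add the live atoms one at
a time; the span either stays put or its dimension goes up), so the rejection region is covered by the all-off events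
`{every atom of an input a with r a ∉ K off}` for the subspaces `K ∌ t` SPANNED BY THE ROWS OF AT MOST `D` ATOMS —
at most `#𝒱(l)^D` events, over an ARBITRARY division ring `F` (finite or not):

* `sg_spanProgram_of_chain_budget` — finite form: positive budget `(ν·C(l,2))^t·C(m-t,k-t) ≤ ε·C(m,k)` and fragility
  budget `#𝒱(l)^D · (1/2)^{ν+1} · #𝒱(l) < ε` give `#lostPos ≤ ε·C(m,k)` and `gainedNeg ≤ ε`;
* `sg_spanProgram_of_dim_mul_log_le` — at the parameters of the line: for every `c`, eventually in `m`, every bundled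
  span program over any division ring with `D · (lOf m · log₂(m+1)) ≤ m^{3/4}/2` (every `D ≤ m^{11/16-o(1)}`) is
  `epsOf c m`-approximated one-sidedly on (bare `kOf m`-cliques) × `G(m, qOf m)` by a small-clique DNF;
* `sgAt_spanGateOver_of_dim_le_rpow` — the `SGAt`-shaped statement for the class of span programs of dimension `D`
  over a given division ring `F`, in the closed-form range `D ≤ m^{11/16}/(8 log₂ m)`.

No new definitions. [folklore]
-/

-- `Summit.PneNP.PneNP.…` duplicates `PneNP` BY DESIGN (single-problem summit).
set_option linter.dupNamespace false

namespace Summit.PneNP.PneNP.Theorems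

open Finset Filter Literature.Computability.Complexity Razborov
open Summit.PneNP.PneNP.Cruxes.LinAlgGateBlind.DnfInvariantWideGatesSeeSmallCliques

/-! ### A span is spanned by few of any given spanning vectors -/

/-- **Few spanning vectors suffice.** In a finite-dimensional space over a division ring, from any finite family of
vectors `r i, i ∈ I` one can select `J ⊆ I` with the same span and `#J ≤ dim`: add the vectors one at a time and keep
only those outside the span so far — each kept vector raises the dimension. [folklore] -/
theorem exists_subset_card_le_finrank_span_eq {F V ι : Type*} [DivisionRing F] [AddCommGroup V] [Module F V]
    [Module.Finite F V] [DecidableEq ι] (r : ι → V) (I : Finset ι) :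
    ∃ J ⊆ I, #J ≤ Module.finrank F V ∧
      Submodule.span F (r '' (J : Set ι)) = Submodule.span F (r '' (I : Set ι)) := by
  classical
  suffices h : ∃ J ⊆ I, #J ≤ Module.finrank F (Submodule.span F (r '' (J : Set ι))) ∧
      Submodule.span F (r '' (J : Set ι)) = Submodule.span F (r '' (I : Set ι)) by
    obtain ⟨J, hJI, hcard, hJ⟩ := h
    exact ⟨J, hJI, hcard.trans (Submodule.finrank_le _), hJ⟩
  induction I using Finset.induction_on with
  | empty => exact ⟨∅, subset_rfl, by simp, rfl⟩
  | insert i I hi ih =>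
    obtain ⟨J, hJI, hcard, hJ⟩ := ih
    have hins : ∀ T : Finset ι, Submodule.span F (r '' ((insert i T : Finset ι) : Set ι)) =
        Submodule.span F {r i} ⊔ Submodule.span F (r '' (T : Set ι)) := by
      intro T
      rw [coe_insert, Set.image_insert_eq, Set.insert_eq, Submodule.span_union]
    by_cases hmem : r i ∈ Submodule.span F (r '' (J : Set ι))
    · refine ⟨J, hJI.trans (subset_insert i I), hcard, ?_⟩
      rw [hins I, ← hJ, eq_comm, sup_eq_right]
      exact Submodule.span_le.2 (Set.singleton_subset_iff.2 hmem)
    · have hiJ : i ∉ J := fun h => hi (hJI h)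
      refine ⟨insert i J, insert_subset_insert i hJI, ?_, by rw [hins J, hins I, hJ]⟩
      rw [card_insert_of_notMem hiJ, hins J]
      set W := Submodule.span F (r '' (J : Set ι)) with hW
      set W' := Submodule.span F {r i} ⊔ Submodule.span F (r '' (J : Set ι)) with hW'
      have hlt : W < W' := by
        refine lt_of_le_of_ne le_sup_right fun h => hmem ?_
        rw [h]
        exact Submodule.mem_sup_left (Submodule.subset_span (Set.mem_singleton (r i)))
      have := Submodule.finrank_lt_finrank_of_lt hlt
      omega

/-! ### SG for span programs from the chain cover -/

/-- **The chain cover of a span-program term gate (finite form of SG).** Let `q ∈ [0,1]`, `1 - q^{C(l,2)} ≤ 1/2`,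
`0 < ε`, `2t ≤ l`, and suppose the POSITIVE budget `(ν·C(l,2))^t · C(m-t, k-t) ≤ ε·C(m,k)` and the FRAGILITY budget
`#𝒱(l)^D · (1/2)^{ν+1} · #𝒱(l) < ε`. Then every bundled span program `O(x) = [tgt ∈ span {r a : ⌈atom a⌉(x)}]` with
rows `r a ∈ F^D` over ANY division ring `F` and atoms in `𝒱(l)` has a small-clique DNF with `#lostPos ≤ ε·C(m,k)` and
`gainedNeg ≤ ε`. Proof: for a `D`-tuple of atoms `f`, put `K_f = span {r a : atom a ∈ range f}`; a graph is rejected iff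
for some `f` with `tgt ∉ K_f` every atom of an input `a` with `r a ∉ K_f` is absent: (⇐) the live rows lie in
`K_f ∌ tgt`; (⇒) the live span is spanned by the rows of `≤ D` live atoms (`exists_subset_card_le_finrank_span_eq`),
listed as `f` padded with the always-present atom `∅`, and then `K_f` is the live span. So the rejection region is
covered by `≤ #𝒱(l)^D` all-off events inside it and the planting theorem `sg_of_maxtermCover` (`η = ε/#𝒱(l)`)
concludes. [folklore] -/
theorem sg_spanProgram_of_chain_budget :
    ∀ (m l k D ν t : ℕ) (q ε : ℝ), 0 ≤ q → q ≤ 1 → 1 - q ^ (l.choose 2) ≤ 1 / 2 → 0 < ε → 2 * t ≤ l →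
      (((ν * l.choose 2) ^ t * (m - t).choose (k - t) : ℕ) : ℝ) ≤ ε * (m.choose k : ℝ) →
      (#(smallSets (Fin m) l) : ℝ) ^ D * (1 / 2) ^ (ν + 1) * #(smallSets (Fin m) l) < ε →
    ∀ {F A : Type} [DivisionRing F] [Fintype A],
    ∀ (r : A → (Fin D → F)) (atom : A → Finset (Fin m)), (∀ a, atom a ∈ smallSets (Fin m) l) →
    ∀ (tgt : Fin D → F) (O : (KEdge m → Bool) → Bool),
      (∀ x, O x = true ↔ tgt ∈ Submodule.span F (r '' {a | CliquePresent (atom a) x})) →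
      ∃ 𝒜 ⊆ smallSets (Fin m) l,
        (#(lostPos m k O 𝒜) : ℝ) ≤ ε * (m.choose k : ℝ) ∧ gainedNeg m q O 𝒜 ≤ ε := by
  intro m l k D ν t q ε hq0 hq1 hql hε htl hpos hfrag F A _ _ r atom hatom tgt O hO
  classical
  set V := smallSets (Fin m) l with hVdef
  have hV : (0 : ℝ) < #V := Nat.cast_pos.2 (card_pos.2 ⟨∅, empty_mem_smallSets l⟩)
  -- the subspace spanned by the rows of the atoms listed by `f`
  set K : (Fin D → V) → Submodule F (Fin D → F) :=
    fun f => Submodule.span F (r '' {a | ∃ i, ((f i : V) : Finset (Fin m)) = atom a}) with hKdef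
  -- the chain cover
  have hiff : ∀ x, O x = false ↔
      ∃ f : Fin D → V, tgt ∉ K f ∧ ∀ a, r a ∉ K f → ¬ CliquePresent (atom a) x := by
    intro x
    constructor
    · intro h0
      have htgt : tgt ∉ Submodule.span F (r '' {a | CliquePresent (atom a) x}) := fun h => by
        have := (hO x).2 h
        rw [h0] at this
        exact Bool.false_ne_true this
      -- few live atoms span the live span
      obtain ⟨J, hJI, hJcard, hJ⟩ :=
        exists_subset_card_le_finrank_span_eq (F := F) r (univ.filter fun a => CliquePresent (atom a) x)
      have hIset : ((univ.filter fun a => CliquePresent (atom a) x : Finset A) : Set A) =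
          {a | CliquePresent (atom a) x} := by
        ext a
        simp
      rw [hIset] at hJ
      rw [Module.finrank_fin_fun] at hJcard
      -- the atoms of `J`, listed as a `D`-tuple padded with `∅`
      set 𝒥 : Finset (Finset (Fin m)) := J.image atom with h𝒥def
      have h𝒥V : 𝒥 ⊆ V := by
        intro Y hY
        obtain ⟨a, -, rfl⟩ := mem_image.1 hY
        exact hatom a
      have h𝒥card : #𝒥 ≤ D := card_image_le.trans hJcard
      set e𝒥 := 𝒥.equivFin with he𝒥
      set f : Fin D → V := fun i =>
        if h : (i : ℕ) < #𝒥 then ⟨(e𝒥.symm ⟨i, h⟩ : Finset (Fin m)), h𝒥V (e𝒥.symm ⟨i, h⟩).2⟩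
        else ⟨∅, empty_mem_smallSets l⟩ with hfdef
      have hf_live : ∀ a, (∃ i, ((f i : V) : Finset (Fin m)) = atom a) → CliquePresent (atom a) x := by
        rintro a ⟨i, hi⟩
        by_cases h : (i : ℕ) < #𝒥
        · have hmem : atom a ∈ 𝒥 := by
            rw [← hi, hfdef]
            simp only [h, dif_pos]
            exact (e𝒥.symm ⟨i, h⟩).2
          obtain ⟨b, hb, hba⟩ := mem_image.1 hmem
          have hb_live : CliquePresent (atom b) x := (mem_filter.1 (hJI hb)).2
          rw [← hba]
          exact hb_live
        · have hempty : atom a = ∅ := by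
            rw [← hi, hfdef]
            simp only [h, dif_neg, not_false_eq_true]
          rw [hempty]
          exact cliquePresent_empty x
      have hJ_listed : ∀ b ∈ J, ∃ i, ((f i : V) : Finset (Fin m)) = atom b := by
        intro b hb
        have hXb : atom b ∈ 𝒥 := mem_image_of_mem atom hb
        refine ⟨⟨e𝒥 ⟨atom b, hXb⟩, lt_of_lt_of_le (e𝒥 ⟨atom b, hXb⟩).2 h𝒥card⟩, ?_⟩
        rw [hfdef]
        simp only [(e𝒥 ⟨atom b, hXb⟩).2, dif_pos, Fin.eta, Equiv.symm_apply_apply]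
      have hKf : K f = Submodule.span F (r '' {a | CliquePresent (atom a) x}) := by
        apply le_antisymm
        · refine Submodule.span_le.2 ?_
          rintro _ ⟨a, ha, rfl⟩
          exact Submodule.subset_span ⟨a, hf_live a ha, rfl⟩
        · rw [← hJ]
          exact Submodule.span_mono (Set.image_mono fun b hb => hJ_listed b hb)
      refine ⟨f, by rwa [hKf], fun a ha hla => ha ?_⟩
      rw [hKf]
      exact Submodule.subset_span ⟨a, hla, rfl⟩
    · rintro ⟨f, htgt, hf⟩
      cases hx : O x
      · rfl
      · exfalso
        have hle : Submodule.span F (r '' {a | CliquePresent (atom a) x}) ≤ K f := by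
          refine Submodule.span_le.2 ?_
          rintro _ ⟨a, ha, rfl⟩
          by_contra hK
          exact hf a hK ha
        exact htgt (hle ((hO x).1 hx))
  -- index the chain cover
  set J := {f : Fin D → V // tgt ∉ K f} with hJ
  set N := Nat.card J with hNdef
  set e : J ≃ Fin N := Finite.equivFin J with he
  set 𝓛 : Fin N → Finset (Finset (Fin m)) :=
    fun j => (univ.filter fun a => r a ∉ K (e.symm j).1).image atom with h𝓛
  have hNle : (N : ℝ) ≤ (#V : ℝ) ^ D := by
    have h1 : N ≤ Nat.card (Fin D → V) :=
      Nat.card_le_card_of_injective (Subtype.val : J → (Fin D → V)) Subtype.val_injective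
    have h2 : Nat.card (Fin D → V) = #V ^ D := by
      rw [Nat.card_eq_fintype_card, Fintype.card_fun, Fintype.card_fin, Fintype.card_coe]
    rw [h2] at h1
    exact_mod_cast h1
  have hN : (N : ℝ) * (1 / 2) ^ (ν + 1) < ε / #V := by
    rw [lt_div_iff₀ hV]
    calc (N : ℝ) * (1 / 2) ^ (ν + 1) * #V ≤ (#V : ℝ) ^ D * (1 / 2) ^ (ν + 1) * #V := by gcongr
      _ < ε := hfrag
  have h1 : ∀ j, 𝓛 j ⊆ V := by
    intro j Y hY
    obtain ⟨a, -, rfl⟩ := mem_image.1 hY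
    exact hatom a
  have h2 : ∀ x, O x = false → ∃ j, ∀ Y ∈ 𝓛 j, ¬ CliquePresent Y x := by
    intro x hx
    obtain ⟨f, htgt, hf⟩ := (hiff x).1 hx
    refine ⟨e ⟨f, htgt⟩, fun Y hY => ?_⟩
    obtain ⟨a, ha, rfl⟩ := mem_image.1 hY
    rw [mem_filter, Equiv.symm_apply_apply] at ha
    exact hf a ha.2
  have h3 : ∀ j x, (∀ Y ∈ 𝓛 j, ¬ CliquePresent Y x) → O x = false := fun j x hall =>
    (hiff x).2 ⟨(e.symm j).1, (e.symm j).2, fun a ha =>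
      hall (atom a) (mem_image_of_mem atom (mem_filter.2 ⟨mem_univ a, ha⟩))⟩
  obtain ⟨𝒜, h𝒜, hP, hNg⟩ := sg_of_maxtermCover m l k N ν t q (ε / #V) O 𝓛 h1 h2 h3
    hq0 hq1 hql (div_pos hε hV) hN htl
  refine ⟨𝒜, h𝒜, ?_, hNg.trans_eq (mul_div_cancel₀ ε hV.ne')⟩
  calc (#(lostPos m k O 𝒜) : ℝ) ≤ (((ν * l.choose 2) ^ t * (m - t).choose (k - t) : ℕ) : ℝ) := by
        exact_mod_cast hP
    _ ≤ ε * (m.choose k : ℝ) := hpos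

/-! ### At the parameters of the line -/

open DenseRegime in
/-- **SG for span programs over any division ring with `D · (lOf m · log₂(m+1)) ≤ m^{3/4}/2`** (every
`D ≤ m^{11/16-o(1)}`), at every level `c`, eventually in `m`: `sg_spanProgram_of_chain_budget` with `ν = ⌈m^{3/4}⌉₊`,
`t = ⌊lOf m/2⌋`, the dense-regime facts (`stub_denseRegime`), the budgets `permSmallDim_budgets` and
`#𝒱(l)^D = 2^{D log₂ #𝒱(l)} ≤ 2^{D · l · log₂(m+1)}` (`Razborov.card_smallSets_le`). [folklore] -/
theorem sg_spanProgram_of_dim_mul_log_le :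
    ∀ c : ℕ, ∀ᶠ m : ℕ in atTop, ∀ (D : ℕ),
      (D : ℝ) * ((lOf m : ℝ) * Real.logb 2 ((m : ℝ) + 1)) ≤ (m : ℝ) ^ (3 / 4 : ℝ) / 2 →
      ∀ {F A : Type} [DivisionRing F] [Fintype A],
      ∀ (r : A → (Fin D → F)) (atom : A → Finset (Fin m)), (∀ a, atom a ∈ smallSets (Fin m) (lOf m)) →
      ∀ (tgt : Fin D → F) (O : (KEdge m → Bool) → Bool),
        (∀ x, O x = true ↔ tgt ∈ Submodule.span F (r '' {a | CliquePresent (atom a) x})) →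
        ∃ 𝒜 ⊆ smallSets (Fin m) (lOf m),
          (#(lostPos m (kOf m) O 𝒜) : ℝ) ≤ epsOf c m * (m.choose (kOf m) : ℝ) ∧
            gainedNeg m (qOf m) O 𝒜 ≤ epsOf c m := by
  intro c
  filter_upwards [stub_denseRegime c, permSmallDim_budgets c, eventually_ge_atTop 1] with m hD hB hm D hdim F A _ _
    r atom hatom tgt O hO
  obtain ⟨-, -, -, hq0, hq1, -, -, -, -, hhalf⟩ := hD
  obtain ⟨hpos, hfrag⟩ := hB
  have hmpos : (0 : ℝ) < m := by exact_mod_cast hm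
  have hε : 0 < epsOf c m := by
    rw [epsOf_eq]
    positivity
  have hV : (0 : ℝ) < #(smallSets (Fin m) (lOf m)) :=
    Nat.cast_pos.2 (card_pos.2 ⟨∅, empty_mem_smallSets (lOf m)⟩)
  have hV1 : (1 : ℝ) ≤ #(smallSets (Fin m) (lOf m)) := by
    exact_mod_cast card_pos.2 ⟨∅, empty_mem_smallSets (lOf m)⟩
  -- `log₂ #𝒱(l) ≤ l · log₂ (m+1)`
  have hlogV : Real.logb 2 (#(smallSets (Fin m) (lOf m)) : ℝ) ≤ (lOf m : ℝ) * Real.logb 2 ((m : ℝ) + 1) := by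
    have h := card_smallSets_le (α := Fin m) (lOf m)
    rw [Fintype.card_fin] at h
    calc Real.logb 2 (#(smallSets (Fin m) (lOf m)) : ℝ) ≤ Real.logb 2 (((m : ℝ) + 1) ^ lOf m) :=
          Real.logb_le_logb_of_le one_lt_two hV (by exact_mod_cast h)
      _ = (lOf m : ℝ) * Real.logb 2 ((m : ℝ) + 1) := Real.logb_pow _ _ _
  have hexp : (D : ℝ) * Real.logb 2 (#(smallSets (Fin m) (lOf m)) : ℝ) ≤ (m : ℝ) ^ (3 / 4 : ℝ) / 2 :=
    (mul_le_mul_of_nonneg_left hlogV (Nat.cast_nonneg D)).trans hdim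
  have hcard : (#(smallSets (Fin m) (lOf m)) : ℝ) ^ D ≤ (2 : ℝ) ^ ((m : ℝ) ^ (3 / 4 : ℝ) / 2) := by
    have : (#(smallSets (Fin m) (lOf m)) : ℝ) ^ D =
        (2 : ℝ) ^ ((D : ℝ) * Real.logb 2 (#(smallSets (Fin m) (lOf m)) : ℝ)) := by
      rw [mul_comm, Real.rpow_mul (by norm_num : (0 : ℝ) ≤ 2), Real.rpow_logb two_pos (by norm_num) hV,
        Real.rpow_natCast]
    rw [this]
    exact Real.rpow_le_rpow_of_exponent_le one_le_two hexp
  refine sg_spanProgram_of_chain_budget m (lOf m) (kOf m) D ⌈(m : ℝ) ^ (3 / 4 : ℝ)⌉₊ (lOf m / 2)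
    (qOf m) (epsOf c m) hq0 hq1 (by linarith) hε (Nat.mul_div_le (lOf m) 2) hpos ?_ r atom hatom tgt O hO
  calc (#(smallSets (Fin m) (lOf m)) : ℝ) ^ D * (1 / 2) ^ (⌈(m : ℝ) ^ (3 / 4 : ℝ)⌉₊ + 1) *
        #(smallSets (Fin m) (lOf m))
      ≤ (2 : ℝ) ^ ((m : ℝ) ^ (3 / 4 : ℝ) / 2) * (1 / 2) ^ (⌈(m : ℝ) ^ (3 / 4 : ℝ)⌉₊ + 1) *
        #(smallSets (Fin m) (lOf m)) := by gcongr
    _ < epsOf c m := hfrag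

open DenseRegime in
/-- **`SGAt` for span programs of dimension `D ≤ m^{11/16}/(8 log₂ m)` over a given division ring `F`** (finite or
not), at every level `c`, eventually in `m`. The class is written inline: gates `g` with rows
`r : Fin g.1 → F^D` and a target `t`, `g.2 v ↔ t ∈ span {r i : v i}`. Proof: `sg_spanProgram_of_dim_mul_log_le` with
`lOf m ≤ m^{1/16} + 1`, `log₂(m+1) ≤ log₂ m + 1`, `(x+1)(L+1) ≤ 4xL`, `m^{11/16} · m^{1/16} = m^{3/4}`. [folklore] -/
theorem sgAt_spanGateOver_of_dim_le_rpow : ∀ (F : Type) [DivisionRing F] (c : ℕ), ∀ᶠ m : ℕ in atTop,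
    ∀ D : ℕ, (D : ℝ) ≤ (m : ℝ) ^ (11 / 16 : ℝ) / (8 * Real.logb 2 m) →
      SGAt m (fun g => ∃ (r : Fin g.1 → Fin D → F) (t : Fin D → F),
          ∀ v, g.2 v = true ↔ t ∈ Submodule.span F (r '' {i | v i = true}))
        (lOf m) (kOf m) (qOf m) (epsOf c m) := by
  intro F _ c
  filter_upwards [sg_spanProgram_of_dim_mul_log_le c, eventually_ge_atTop 2] with m hm hm2 D hD O hO
  obtain ⟨g, ⟨r, t, hg⟩, X, hX, hOX⟩ := hO
  have hm1 : 1 ≤ m := le_trans (by norm_num) hm2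
  have hmR : (2 : ℝ) ≤ m := by exact_mod_cast hm2
  have hmpos : (0 : ℝ) < m := by linarith
  have hx1 : (1 : ℝ) ≤ (m : ℝ) ^ (1 / 16 : ℝ) := one_le_rpow_sixteenth hm1
  have hL1 : 1 ≤ Real.logb 2 m := by
    rw [← Real.logb_self_eq_one one_lt_two]
    exact Real.logb_le_logb_of_le one_lt_two two_pos hmR
  have hlOf : (lOf m : ℝ) ≤ (m : ℝ) ^ (1 / 16 : ℝ) + 1 := lOf_le_rpow_add_one m
  have hlog : Real.logb 2 ((m : ℝ) + 1) ≤ Real.logb 2 m + 1 :=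
    calc Real.logb 2 ((m : ℝ) + 1) ≤ Real.logb 2 (2 * m) :=
          Real.logb_le_logb_of_le one_lt_two (by positivity) (by linarith)
      _ = Real.logb 2 2 + Real.logb 2 m := Real.logb_mul (by norm_num) hmpos.ne'
      _ = Real.logb 2 m + 1 := by rw [Real.logb_self_eq_one one_lt_two, add_comm]
  have hlog0 : 0 ≤ Real.logb 2 ((m : ℝ) + 1) := Real.logb_nonneg one_lt_two (by linarith)
  have hfac : (lOf m : ℝ) * Real.logb 2 ((m : ℝ) + 1) ≤ 4 * (m : ℝ) ^ (1 / 16 : ℝ) * Real.logb 2 m :=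
    calc (lOf m : ℝ) * Real.logb 2 ((m : ℝ) + 1) ≤ ((m : ℝ) ^ (1 / 16 : ℝ) + 1) * (Real.logb 2 m + 1) :=
          mul_le_mul hlOf hlog hlog0 (by positivity)
      _ ≤ (2 * (m : ℝ) ^ (1 / 16 : ℝ)) * (2 * Real.logb 2 m) :=
          mul_le_mul (by linarith) (by linarith) (by linarith) (by linarith)
      _ = 4 * (m : ℝ) ^ (1 / 16 : ℝ) * Real.logb 2 m := by ring
  have h34 : (m : ℝ) ^ (11 / 16 : ℝ) * (m : ℝ) ^ (1 / 16 : ℝ) = (m : ℝ) ^ (3 / 4 : ℝ) := by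
    rw [← Real.rpow_add hmpos]
    norm_num
  have hdim : (D : ℝ) * ((lOf m : ℝ) * Real.logb 2 ((m : ℝ) + 1)) ≤ (m : ℝ) ^ (3 / 4 : ℝ) / 2 :=
    calc (D : ℝ) * ((lOf m : ℝ) * Real.logb 2 ((m : ℝ) + 1))
        ≤ (m : ℝ) ^ (11 / 16 : ℝ) / (8 * Real.logb 2 m) * (4 * (m : ℝ) ^ (1 / 16 : ℝ) * Real.logb 2 m) :=
          mul_le_mul hD hfac (mul_nonneg (Nat.cast_nonneg _) hlog0) (div_nonneg (by positivity) (by positivity))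
      _ = (m : ℝ) ^ (11 / 16 : ℝ) * (m : ℝ) ^ (1 / 16 : ℝ) / 2 := by
          field_simp
          ring
      _ = (m : ℝ) ^ (3 / 4 : ℝ) / 2 := by rw [h34]
  refine hm D hdim r X hX t O fun x => ?_
  rw [hOX x, hg]
  have hset : {i | (fun a => atomB (X a) x) i = true} = {a | CliquePresent (X a) x} := by
    ext a
    simp [atomB]
  rw [hset]

end Summit.PneNP.PneNP.Theorems
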